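/-
Copyright (c) 2026 the pub-hodgecm-mathlib formalisation cell (harness21).  Prover seat hodgecm-mathlib-K2E4-p01 (g2), Track B ∕ K2-LIT,
h413 = `stmt-HodgeConjecture-24833`; road «(B)∣split» (HC density at the centre of `GL₂ × GL₁`), FILE C = the interface (HC₁^P) with
K2E4-p02 (g0)'s T0 (bytes `K2/K2E4-p01/g2/HC1P.sig.lean` 66cb6986559f4098).  2026-09-03∕04.
-/
import Summits.HodgeConjecture.HodgeConjecture.Theorems.K2E3GLTwoRamifiedShellUnfolding     -- ★ FILE B2 (this seat): the shell sum; B1 shells∕weights; A shell shift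
import Summits.HodgeConjecture.HodgeConjecture.Theorems.K2E3GLTwoRamifiedTorusCompactCore   -- ★ FILE C1 (this seat): normalised torus measure on `C_P((γ, a))`, closed class
import Literature.NumberTheory.Automorphic.CongruenceSubgroupExpansionGL                  -- ★ `exists_congruenceGL_pow_subset`, `exists_isUniformizingElement`
import Literature.NumberTheory.Automorphic.LocalOrbitalMeasure                             -- ★ `isClosed_coe_centralizer_singleton`
import Literature.NumberTheory.Automorphic.GodementJacquetLocalNonvanishing                -- ★ `t2Space_of_isNonarchimedeanLocalField`
import Literature.NumberTheory.Rogawski1990.LocalTransferFundamentalLemma                  -- ★ `IsLocSmooth`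
import Literature.Topology.LocallyConstantCompactSupportUniform                           -- ★ `exists_nhds_one_forall_mul_eq_of_hasCompactSupport`
import Literature.Topology.LocallyConstantConjugationAverage                              -- ★ `exists_finset_conj_sum_invariant_of_hasCompactSupport` (finite `K`-averaging)
import Mathlib.NumberTheory.LocalField.Basic
import HarnessLib

/-!
# h413 ∕ Track B «K2-LIT» — (HC₁^P): HARISH-CHANDRA DENSITY AT THE CENTRE OF `GL₂(F) × GL₁(F)` from the vanishing of the canonical
# orbital integrals at the elliptic-regular classes (one ramified torus, two depths)

Cell `pub/hodgecm-mathlib`, crux H413 = `stmt-HodgeConjecture-24833` (supports-only); E3 socket (B) `sig_K2E3CentralTransferVanishing` at a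
SPLIT place, reduced by K2E4-p02 (g0)'s T0 (`Theorems/K2E3CentralTransferVanishingSplit*.lean`) to the statement proved here BY NAME:
**`apply_scalar_eq_zero_of_forall_orbitalIntegral_eq_zero`** (bytes of `K2/K2E4-p01/g2/HC1P.sig.lean`): for `ψ ∈ C_c^∞(P)`, `P = GL₂(F) × GL₁(F)`
over a non-archimedean local field `F`, if `O_{(h,u)}^{ν∕ρ}(ψ) = 0` at every `(h, u)` with `tr(h)² − 4 det h ≠ 0`, `charpoly(h)(u) ≠ 0` and `ρ` the
Haar measure of `C_P((h,u))` normalised by `ρ(compactCore) = 1`, then `ψ(z·1, c) = 0` for all `z, c ∈ F^×`.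

PROOF (Labesse–Langlands' shell sum for ONE ramified torus at TWO depths — no germ expansion, no Plancherel):
* (FILE C1 ★ `K2E3GLTwoRamifiedTorusCompactCore`) the normalised torus measure on `C = C_P((γ, a))` exists (`compactCore C = C ∩ K_P` compact open) and the
  class of `(h, a)` is closed for `tr(h)² − 4 det h ≠ 0`.
* §2 the `K_P`-conjugation-invariant case `apply_scalar_eq_zero_of_conj_invariant`: pick an Eisenstein torus `τ² = uτ + v` (`u² + 4v ≠ 0`), the deep
  elements `γ_n = z(1 + ϖⁿτ)` (FILE A), a level `m` with `ψ` right-`K(ϖ^m)`-invariant (★ uniform local constancy + ★ `exists_congruenceGL_pow_subset`);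
  for `n ≥ m` the shell sums `S_n = Σ_r q^r ψ(X_r (γ_n, c) X_r⁻¹)` (FILE B2, `O_{(γ_n,c)} = w_n S_n`, `w_n > 0`) satisfy **`S_{n+1} = q S_n + ψ(z·1, c)`**
  by the shell shift of FILE A; two vanishing depths give `ψ(z·1, c) = 0`.
* §3 the general case by FINITE `K_P`-averaging (★ `exists_finset_conj_sum_invariant_of_hasCompactSupport`; conjugation does not change canonical
  orbital integrals: `G`-invariance of `ν∕ρ`, ★ `smulInvariantMeasure_quotientMeasure`).

HONEST LABEL: HC_CM is proved only modulo the 7 printed citations (2 remaining named inputs: hLiu418 = `stmt-HodgeConjecture-24832`,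
h413 = `stmt-HodgeConjecture-24833`) until rung 0 closes; this file is an unconditional local lemma and moves no counter by itself.

## References
* [HarishChandra1999AdmissibleDistributions] Harish-Chandra (DeBacker–Sally), *Admissible Invariant Distributions on Reductive p-adic Groups*, AMS ULS 16 (1999), Thm. 3.1.
* [LabesseLanglands1979] J.-P. Labesse, R. P. Langlands, *L-indistinguishability for SL(2)*, Canad. J. Math. 31 (1979), §2 pp. 7–9.
* [Rogawski1990] J. D. Rogawski, *Automorphic Representations of Unitary Groups in Three Variables* (1990), §8.1 p. 116 (`Γ₁ = (−1)^q d⁻¹ ≠ 0`), §4.9 p. 54.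
-/

set_option autoImplicit false
set_option linter.dupNamespace false

noncomputable section

open scoped ValuativeRel Matrix MatrixGroups ENNReal
open Matrix ValuativeRel MeasureTheory Measure Topology Filter
open Literature.MeasureTheory.Group Literature.NumberTheory.Automorphic Literature.NumberTheory.Automorphic.HermitianLatticeTree
open Literature.NumberTheory.Rogawski1990 (IsLocSmooth)
open Summit.HodgeConjecture.HodgeConjecture.Cruxes.H413.K2E3GLTwoRamifiedShellShift
open Summit.HodgeConjecture.HodgeConjecture.Cruxes.H413.K2E3GLTwoRamifiedShellStabilizers
open Summit.HodgeConjecture.HodgeConjecture.Cruxes.H413.K2E3GLTwoRamifiedShellUnfolding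
open Summit.HodgeConjecture.HodgeConjecture.Cruxes.H413.K2E3GLTwoRamifiedTorusCompactCore

namespace Summit.HodgeConjecture.HodgeConjecture.Cruxes.H413.K2E3GLTwoCentralDensityRamifiedTorus

variable {F : Type*} [Field F] [ValuativeRel F] [TopologicalSpace F] [IsNonarchimedeanLocalField F]

/-! ## §2 The `K_P`-conjugation-invariant case: two depths on one ramified torus -/

section Engine

variable [MeasurableSpace (GL (Fin 2) F × GL (Fin 1) F)] [BorelSpace (GL (Fin 2) F × GL (Fin 1) F)]
  [T2Space (GL (Fin 2) F × GL (Fin 1) F)] [LocallyCompactSpace (GL (Fin 2) F × GL (Fin 1) F)]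
  [SecondCountableTopology (GL (Fin 2) F × GL (Fin 1) F)]
  [∀ Γ : GL (Fin 2) F × GL (Fin 1) F, MeasurableSpace ((GL (Fin 2) F × GL (Fin 1) F) ⧸ Subgroup.centralizer ({Γ} : Set (GL (Fin 2) F × GL (Fin 1) F)))]
  [∀ Γ : GL (Fin 2) F × GL (Fin 1) F, BorelSpace ((GL (Fin 2) F × GL (Fin 1) F) ⧸ Subgroup.centralizer ({Γ} : Set (GL (Fin 2) F × GL (Fin 1) F)))]

/-- **(HC₁^P) FOR `K_P`-CONJUGATION-INVARIANT TEST FUNCTIONS, at a given Eisenstein torus** `τ² = uτ + v` (`u ∈ 𝔭`, `|v| = |ϖ|`, `u² + 4v ≠ 0`):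
if the canonical orbital integrals of `ψ` vanish at the elliptic-regular classes `(h, u)` of (HC₁^P), then `ψ(z·1, c) = 0`.  Two depths `m, m+1` of the deep
elements `γ_n = z(1 + ϖⁿτ)` (`m` = a right-invariance level of `ψ`) and the recursion `S_{m+1} = q·S_m + ψ(z·1, c)` of the shell sums (FILE B2 + FILE A).
[cite: LabesseLanglands1979, §2 pp. 8–9] [cite: HarishChandra1999AdmissibleDistributions, Thm. 3.1] -/
theorem apply_scalar_eq_zero_of_conj_invariant (ν : Measure (GL (Fin 2) F × GL (Fin 1) F)) [ν.IsHaarMeasure] [ν.IsMulRightInvariant]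
    (ψ : GL (Fin 2) F × GL (Fin 1) F → ℂ) (hψ : IsLocSmooth ψ) (hψK : ∀ k ∈ (glInt 2 F).prod (glInt 1 F), ∀ y, ψ (k * y * k⁻¹) = ψ y)
    (hO : ∀ (h : GL (Fin 2) F) (u : GL (Fin 1) F),
      (h : Matrix (Fin 2) (Fin 2) F).trace ^ 2 - 4 * (h : Matrix (Fin 2) (Fin 2) F).det ≠ 0 →
      ((h : Matrix (Fin 2) (Fin 2) F).charpoly).eval ((u : Matrix (Fin 1) (Fin 1) F) 0 0) ≠ 0 →
      ∀ (ρ : Measure (Subgroup.centralizer ({(h, u)} : Set (GL (Fin 2) F × GL (Fin 1) F))))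
        [ρ.IsHaarMeasure] [ρ.IsInvInvariant],
        ρ (compactCore (Subgroup.centralizer ({(h, u)} : Set (GL (Fin 2) F × GL (Fin 1) F)))) = 1 →
        orbitalIntegral (h, u) ψ
          (quotientMeasure (Subgroup.centralizer ({(h, u)} : Set (GL (Fin 2) F × GL (Fin 1) F))) ρ
            (isClosed_coe_centralizer_singleton (h, u)) ν) = 0)
    {ϖ : F} (hϖ : IsUniformizingElement ϖ) {u v : F} (hu : u ∈ 𝒪[F]) (hu1 : valuation F u < 1) (hv1 : valuation F v = valuation F ϖ)
    (hdisc : u ^ 2 + 4 * v ≠ 0) (z c : Fˣ) :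
    ψ (Units.map (Matrix.scalar (Fin 2) : F →+* Matrix (Fin 2) (Fin 2) F).toMonoidHom z,
       Units.map (Matrix.scalar (Fin 1) : F →+* Matrix (Fin 1) (Fin 1) F).toMonoidHom c) = 0 := by
  classical
  haveI : T2Space F := t2Space_of_isNonarchimedeanLocalField
  have h0 := hϖ.ne_zero
  have hϖ1 := hϖ.valuation_lt_one
  have hv : v ∈ 𝒪[F] := by rw [Valuation.mem_integer_iff, hv1]; exact hϖ.valuation_le_one
  have hv0 : v ≠ 0 := fun h => by rw [h, map_zero] at hv1; exact (Valuation.ne_zero_iff _).2 h0 hv1.symm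
  have hE := quadNormForm_integral_of_eisenstein hϖ hu hu1 hv1
  -- the scalars
  set zS := Units.map (Matrix.scalar (Fin 2) : F →+* Matrix (Fin 2) (Fin 2) F).toMonoidHom z with hzSdef
  set cu := Units.map (Matrix.scalar (Fin 1) : F →+* Matrix (Fin 1) (Fin 1) F).toMonoidHom c with hcudef
  have hzS : (zS : Matrix (Fin 2) (Fin 2) F) = !![(z : F), 0; 0, z] := by
    rw [hzSdef, Units.coe_map]
    ext i j
    fin_cases i <;> fin_cases j <;> simp [Matrix.scalar_apply]
  have hcu : ((cu : Matrix (Fin 1) (Fin 1) F) 0 0) = (c : F) := by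
    rw [hcudef, Units.coe_map]; simp [Matrix.scalar_apply]
  -- the torus `τ² = uτ + v`, its deep elements `γ_n = z(1 + ϖⁿτ)` and the shell representatives `r_m = diag(1, ϖ^m)`
  set γτ : GL (Fin 2) F := Matrix.GeneralLinearGroup.mkOfDetNeZero !![0, v; 1, u] (by rw [Matrix.det_fin_two]; simp [hv0]) with hγτdef
  have hγτ : (γτ : Matrix (Fin 2) (Fin 2) F) = !![0, v; 1, u] := rfl
  have hδ : ∀ n : ℕ, valuation F (1 + ϖ ^ n * u - ϖ ^ (2 * n) * v) = 1 := fun n => by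
    have h1 : valuation F (ϖ ^ n * u - ϖ ^ (2 * n) * v) < 1 := by
      refine lt_of_le_of_lt (Valuation.map_sub _ _ _) (max_lt ?_ ?_)
      · rw [map_mul, map_pow]; exact mul_lt_one_of_nonneg_of_lt_one_right (pow_le_one₀ zero_le hϖ1.le) zero_le hu1
      · rw [map_mul, map_pow, hv1]; exact mul_lt_one_of_nonneg_of_lt_one_right (pow_le_one₀ zero_le hϖ1.le) zero_le hϖ1
    rw [add_sub_assoc, Valuation.map_one_add_of_lt _ h1]
  have hdet : ∀ n : ℕ, Matrix.det !![(z : F), z * ϖ ^ n * v; z * ϖ ^ n, z + z * ϖ ^ n * u] ≠ 0 := fun n => by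
    have : Matrix.det !![(z : F), z * ϖ ^ n * v; z * ϖ ^ n, z + z * ϖ ^ n * u] = (z : F) ^ 2 * (1 + ϖ ^ n * u - ϖ ^ (2 * n) * v) := by
      rw [Matrix.det_fin_two]; simp; ring
    rw [this]
    refine mul_ne_zero (pow_ne_zero _ z.ne_zero) fun h => ?_
    have := hδ n
    rw [h, map_zero] at this
    exact zero_ne_one this
  set γ : ℕ → GL (Fin 2) F := fun n => Matrix.GeneralLinearGroup.mkOfDetNeZero _ (hdet n) with hγdef
  have hγ : ∀ n, (γ n : Matrix (Fin 2) (Fin 2) F) = !![(z : F), z * ϖ ^ n * v; z * ϖ ^ n, z + z * ϖ ^ n * u] := fun n => rfl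
  have hb : ∀ n : ℕ, (z : F) * ϖ ^ n ≠ 0 := fun n => mul_ne_zero z.ne_zero (pow_ne_zero _ h0)
  set rm : ℕ → GL (Fin 2) F := fun m => Matrix.GeneralLinearGroup.mkOfDetNeZero (Matrix.diagonal ![(1 : F), ϖ ^ m])
    (by rw [Matrix.det_diagonal]; simp [h0]) with hrmdef
  have hrm : ∀ m, (rm m : Matrix (Fin 2) (Fin 2) F) = Matrix.diagonal ![(1 : F), ϖ ^ m] := fun m => rfl
  have hCn : ∀ n, Subgroup.centralizer ({γ n} : Set (GL (Fin 2) F)) = Subgroup.centralizer ({γτ} : Set (GL (Fin 2) F)) := fun n =>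
    centralizer_deep_eq_centralizer_companion (hb n) (hγ n) hγτ
  have hdisc' : ∀ n, (γ n : Matrix (Fin 2) (Fin 2) F).trace ^ 2 - 4 * (γ n : Matrix (Fin 2) (Fin 2) F).det ≠ 0 := fun n => by
    rw [trace_sq_sub_four_mul_det_regRep u v (z : F) (z * ϖ ^ n) (hγ n)]
    exact mul_ne_zero (pow_ne_zero _ (hb n)) hdisc
  have heval : ∀ n, ((γ n : Matrix (Fin 2) (Fin 2) F).charpoly).eval ((cu : Matrix (Fin 1) (Fin 1) F) 0 0) ≠ 0 := fun n => by
    rw [hcu]; exact eval_charpoly_regRep_ne_zero hϖ hE (hb n) (c : F) (hγ n)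
  have hOcl : ∀ n, IsClosed {g : GL (Fin 2) F × GL (Fin 1) F | ∃ y : GL (Fin 2) F × GL (Fin 1) F, y * (γ n, cu) * y⁻¹ = g} := fun n =>
    isClosed_conjClass_pair (γ n) (hdisc' n) cu
  -- `K_P` and the shell conjugates
  have hKo : IsOpen (((glInt 2 F).prod (glInt 1 F) : Subgroup (GL (Fin 2) F × GL (Fin 1) F)) : Set (GL (Fin 2) F × GL (Fin 1) F)) := isOpen_prodGlInt
  have hKc : IsCompact (((glInt 2 F).prod (glInt 1 F) : Subgroup (GL (Fin 2) F × GL (Fin 1) F)) : Set (GL (Fin 2) F × GL (Fin 1) F)) :=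
    isCompact_prodGlInt
  have hXconj : ∀ n r, (((rm r)⁻¹, 1) : GL (Fin 2) F × GL (Fin 1) F) * (γ n, cu) * (((rm r)⁻¹, 1) : GL (Fin 2) F × GL (Fin 1) F)⁻¹ =
      ((rm r)⁻¹ * γ n * rm r, cu) := fun n r => by
    simp only [Prod.mk_mul_mk, Prod.inv_mk, inv_inv, one_mul, inv_one, mul_one]
  -- a right-invariance level `m ≥ 1` of `ψ` in the `GL₂` variable
  obtain ⟨V, hV, hVψ⟩ := Literature.Topology.exists_nhds_one_forall_mul_eq_of_hasCompactSupport hψ.1 hψ.2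
  have hU : (fun g : GL (Fin 2) F => ((g, 1) : GL (Fin 2) F × GL (Fin 1) F)) ⁻¹' V ∈ 𝓝 (1 : GL (Fin 2) F) :=
    (continuous_id.prodMk continuous_const).continuousAt.preimage_mem_nhds (by exact hV)
  obtain ⟨m, hm, hmU⟩ := exists_congruenceGL_pow_subset hϖ hU
  have hright : ∀ k ∈ congruenceGL 2 (valuation F ϖ ^ m), ∀ x : GL (Fin 2) F, ψ (x * k, cu) = ψ (x, cu) := fun k hk x => by
    have := hVψ (x, cu) (k, 1) (hmU hk)
    simpa only [Prod.mk_mul_mk, mul_one] using this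
  -- THE SHELL SUM AT DEPTH `n ≥ 1` VANISHES (FILE B2 + the hypothesis `hO` at the normalised torus measure of §1)
  have hunfold : ∀ n, 1 ≤ n → ∀ R : ℕ,
      (∀ r, R ≤ r → ψ ((((rm r)⁻¹, 1) : GL (Fin 2) F × GL (Fin 1) F) * (γ n, cu) * (((rm r)⁻¹, 1) : GL (Fin 2) F × GL (Fin 1) F)⁻¹) = 0) →
      ∑ r ∈ Finset.range R, ((Nat.card (IsLocalRing.ResidueField 𝒪[F]) : ℝ) ^ r) •
        ψ ((((rm r)⁻¹, 1) : GL (Fin 2) F × GL (Fin 1) F) * (γ n, cu) * (((rm r)⁻¹, 1) : GL (Fin 2) F × GL (Fin 1) F)⁻¹) = 0 := by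
    intro n hn R hR
    have hCl : IsClosed ((Subgroup.centralizer ({(γ n, cu)} : Set (GL (Fin 2) F × GL (Fin 1) F)) : Set (GL (Fin 2) F × GL (Fin 1) F))) :=
      isClosed_coe_centralizer_singleton (γ n, cu)
    haveI : LocallyCompactSpace (Subgroup.centralizer ({(γ n, cu)} : Set (GL (Fin 2) F × GL (Fin 1) F))) :=
      hCl.isClosedEmbedding_subtypeVal.locallyCompactSpace
    obtain ⟨ρ, hρ1, hρ2, hρ3⟩ := exists_isHaarMeasure_compactCore_centralizer_pair_eq_one hϖ hu hu1 hv1 hγτ (hCn n) cu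
    haveI := hρ1
    haveI := hρ2
    have hO0 := hO (γ n) cu (hdisc' n) (heval n) ρ hρ3
    rw [orbitalIntegral_eq_sum_range_shell hϖ hu hu1 hv1 hγτ (hCn n) cu hrm (hOcl n) hψ.continuous hψ.2 hψK ρ ν hR] at hO0
    simp_rw [mul_smul] at hO0
    rw [← Finset.smul_sum, smul_eq_zero] at hO0
    refine hO0.resolve_left ?_
    -- the weight `ν(K_P) ∕ ρ(A_0)` is a positive real
    have hA1 : (((glInt 2 F).prod (glInt 1 F)).comap ((MulAut.conj (1 : GL (Fin 2) F × GL (Fin 1) F)).toMonoidHom.comp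
          (Subgroup.centralizer ({(γ n, cu)} : Set (GL (Fin 2) F × GL (Fin 1) F))).subtype) :
          Set (Subgroup.centralizer ({(γ n, cu)} : Set (GL (Fin 2) F × GL (Fin 1) F)))) =
        Subtype.val ⁻¹' (((glInt 2 F).prod (glInt 1 F) : Subgroup (GL (Fin 2) F × GL (Fin 1) F)) : Set (GL (Fin 2) F × GL (Fin 1) F)) := by
      ext x; rw [SetLike.mem_coe, mem_stab_iff, one_mul, inv_one, mul_one]; rfl
    have hA1pos : ρ ((((glInt 2 F).prod (glInt 1 F)).comap ((MulAut.conj (1 : GL (Fin 2) F × GL (Fin 1) F)).toMonoidHom.comp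
          (Subgroup.centralizer ({(γ n, cu)} : Set (GL (Fin 2) F × GL (Fin 1) F))).subtype) :
          Set (Subgroup.centralizer ({(γ n, cu)} : Set (GL (Fin 2) F × GL (Fin 1) F))))) ≠ 0 := by
      rw [hA1]; exact ((hKo.preimage continuous_subtype_val).measure_pos ρ ⟨1, Subgroup.one_mem _⟩).ne'
    have hA1top : ρ ((((glInt 2 F).prod (glInt 1 F)).comap ((MulAut.conj (1 : GL (Fin 2) F × GL (Fin 1) F)).toMonoidHom.comp
          (Subgroup.centralizer ({(γ n, cu)} : Set (GL (Fin 2) F × GL (Fin 1) F))).subtype) :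
          Set (Subgroup.centralizer ({(γ n, cu)} : Set (GL (Fin 2) F × GL (Fin 1) F))))) ≠ ∞ := by
      rw [hA1]; exact ((hCl.isClosedEmbedding_subtypeVal.isCompact_preimage hKc).measure_lt_top (μ := ρ)).ne
    refine (ENNReal.toReal_pos (ENNReal.div_pos_iff.2 ⟨(hKo.measure_pos ν ⟨1, Subgroup.one_mem _⟩).ne', hA1top⟩).ne'
      (ENNReal.div_lt_top hKc.measure_lt_top.ne hA1pos).ne).ne'
  -- support bounds at depths `m` and `m + 1`
  obtain ⟨R₁, hR₁⟩ := exists_forall_le_apply_shellConj_eq_zero hϖ hu hv hE hγτ (hCn m) cu hrm (hOcl m) hψ.2 hψK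
  obtain ⟨R₂, hR₂⟩ := exists_forall_le_apply_shellConj_eq_zero hϖ hu hv hE hγτ (hCn (m + 1)) cu hrm (hOcl (m + 1)) hψ.2 hψK
  have hS₁ := hunfold m hm (max R₁ R₂) fun r hr => hR₁ r ((le_max_left _ _).trans hr)
  have hS₂ := hunfold (m + 1) (by omega) (max R₁ R₂ + 1) fun r hr => hR₂ r (by omega)
  -- THE SHELL SHIFT (FILE A): term `r + 1` at depth `m + 1` = term `r` at depth `m`; term `0` at depth `m + 1` = `ψ(z·1, c)`
  have hshift : ∀ r, ψ ((((rm (r + 1))⁻¹, 1) : GL (Fin 2) F × GL (Fin 1) F) * (γ (m + 1), cu) * (((rm (r + 1))⁻¹, 1) : GL (Fin 2) F × GL (Fin 1) F)⁻¹) =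
      ψ ((((rm r)⁻¹, 1) : GL (Fin 2) F × GL (Fin 1) F) * (γ m, cu) * (((rm r)⁻¹, 1) : GL (Fin 2) F × GL (Fin 1) F)⁻¹) := fun r => by
    obtain ⟨k, hk, hkeq⟩ := exists_shellConj_succ_eq_mul_of_mem_congruenceGL hϖ hu hv (z : F) hm r (hγ m) (hγ (m + 1)) (hrm r) (hrm (r + 1))
    rw [hXconj, hXconj, hkeq, hright k hk]
  have hbase : ψ ((((rm 0)⁻¹, 1) : GL (Fin 2) F × GL (Fin 1) F) * (γ (m + 1), cu) * (((rm 0)⁻¹, 1) : GL (Fin 2) F × GL (Fin 1) F)⁻¹) = ψ (zS, cu) := by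
    obtain ⟨k, hk, hkeq⟩ := exists_deep_eq_scalar_mul_of_mem_congruenceGL hϖ hu hv (z : F) (n := m + 1) (by omega) (hγ (m + 1)) hzS
    have hk' : k ∈ congruenceGL 2 (valuation F ϖ ^ m) :=
      congruenceGL_mono (pow_le_pow_right_of_le_one' hϖ.valuation_le_one (Nat.le_succ m)) hk
    rw [shellRep_zero_eq_one hrm, one_mul, inv_one, mul_one, hkeq, hright k hk']
  -- `S_{m+1} = q • S_m + ψ(z·1, c)` and both shell sums vanish
  rw [Finset.sum_range_succ', pow_zero, one_smul, hbase] at hS₂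
  simp_rw [hshift, pow_succ, mul_comm _ ((Nat.card (IsLocalRing.ResidueField 𝒪[F]) : ℝ)), mul_smul] at hS₂
  rw [← Finset.smul_sum, hS₁, smul_zero, zero_add] at hS₂
  exact hS₂

end Engine

/-! ## §3 (HC₁^P): the general case by finite `K_P`-averaging -/

section Main

/-- **(HC₁^P)**: for `ψ ∈ C_c^∞(GL₂(F) × GL₁(F))`, if the orbital integral of `ψ` against the canonical quotient measure `ν ∕ ρ`
(`ρ` the Haar measure of the centraliser normalised by `ρ(compactCore) = 1`) vanishes at every class `(h, u)` with `h` regular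
semisimple (`tr² − 4 det ≠ 0`) and `u` not an eigenvalue of `h`, then `ψ` vanishes at every central element `(z·1, c)` — Harish-Chandra density
at the centre, proved on ONE ramified torus at TWO depths (§2) after a finite `K_P`-conjugation average (conjugation does not change canonical orbital
integrals).  BYTES = `K2/K2E4-p01/g2/HC1P.sig.lean` (interface with K2E4-p02 (g0)'s T0 for the E3 socket (B) at split places).
[cite: HarishChandra1999AdmissibleDistributions, Thm. 3.1] [cite: LabesseLanglands1979, §2 p. 8] [cite: Rogawski1990, §8.1 p. 116] -/
theorem apply_scalar_eq_zero_of_forall_orbitalIntegral_eq_zero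
    [MeasurableSpace (GL (Fin 2) F × GL (Fin 1) F)] [BorelSpace (GL (Fin 2) F × GL (Fin 1) F)]
    [T2Space (GL (Fin 2) F × GL (Fin 1) F)] [LocallyCompactSpace (GL (Fin 2) F × GL (Fin 1) F)]
    [SecondCountableTopology (GL (Fin 2) F × GL (Fin 1) F)]
    [∀ γ : GL (Fin 2) F × GL (Fin 1) F,
      MeasurableSpace ((GL (Fin 2) F × GL (Fin 1) F) ⧸ Subgroup.centralizer ({γ} : Set (GL (Fin 2) F × GL (Fin 1) F)))]
    [∀ γ : GL (Fin 2) F × GL (Fin 1) F,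
      BorelSpace ((GL (Fin 2) F × GL (Fin 1) F) ⧸ Subgroup.centralizer ({γ} : Set (GL (Fin 2) F × GL (Fin 1) F)))]
    (ν : Measure (GL (Fin 2) F × GL (Fin 1) F)) [ν.IsHaarMeasure] [ν.IsMulRightInvariant]
    (ψ : GL (Fin 2) F × GL (Fin 1) F → ℂ) (hψ : IsLocSmooth ψ)
    (hO : ∀ (h : GL (Fin 2) F) (u : GL (Fin 1) F),
      (h : Matrix (Fin 2) (Fin 2) F).trace ^ 2 - 4 * (h : Matrix (Fin 2) (Fin 2) F).det ≠ 0 →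
      ((h : Matrix (Fin 2) (Fin 2) F).charpoly).eval ((u : Matrix (Fin 1) (Fin 1) F) 0 0) ≠ 0 →
      ∀ (ρ : Measure (Subgroup.centralizer ({(h, u)} : Set (GL (Fin 2) F × GL (Fin 1) F))))
        [ρ.IsHaarMeasure] [ρ.IsInvInvariant],
        ρ (compactCore (Subgroup.centralizer ({(h, u)} : Set (GL (Fin 2) F × GL (Fin 1) F)))) = 1 →
        orbitalIntegral (h, u) ψ
          (quotientMeasure (Subgroup.centralizer ({(h, u)} : Set (GL (Fin 2) F × GL (Fin 1) F))) ρ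
            (isClosed_coe_centralizer_singleton (h, u)) ν) = 0)
    (z c : Fˣ) :
    ψ (Units.map (Matrix.scalar (Fin 2) : F →+* Matrix (Fin 2) (Fin 2) F).toMonoidHom z,
       Units.map (Matrix.scalar (Fin 1) : F →+* Matrix (Fin 1) (Fin 1) F).toMonoidHom c) = 0 := by
  classical
  obtain ⟨ϖ, hϖ⟩ := exists_isUniformizingElement (F := F)
  -- an Eisenstein torus with non-zero discriminant (`τ² = ϖτ + ϖ` in characteristic `2`, `τ² = ϖ` otherwise)
  obtain ⟨u, v, hu, hu1, hv1, hdisc⟩ : ∃ u v : F, u ∈ 𝒪[F] ∧ valuation F u < 1 ∧ valuation F v = valuation F ϖ ∧ u ^ 2 + 4 * v ≠ 0 := by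
    have h4 : (4 : F) = 2 * 2 := by norm_num
    by_cases h2 : (2 : F) = 0
    · refine ⟨ϖ, ϖ, hϖ.mem, hϖ.valuation_lt_one, rfl, ?_⟩
      rw [h4, h2, zero_mul, zero_mul, add_zero]
      exact pow_ne_zero _ hϖ.ne_zero
    · refine ⟨0, ϖ, Subring.zero_mem _, by rw [map_zero]; exact zero_lt_one, rfl, ?_⟩
      rw [zero_pow two_ne_zero, zero_add, h4]
      exact mul_ne_zero (mul_ne_zero h2 h2) hϖ.ne_zero
  -- finite `K_P`-averaging
  have hKc : IsCompact (((glInt 2 F).prod (glInt 1 F) : Subgroup (GL (Fin 2) F × GL (Fin 1) F)) : Set (GL (Fin 2) F × GL (Fin 1) F)) :=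
    isCompact_prodGlInt
  obtain ⟨nK, kf, hnK, -, hinv⟩ :=
    Literature.Topology.exists_finset_conj_sum_invariant_of_hasCompactSupport (K := (glInt 2 F).prod (glInt 1 F)) hKc hψ.1 hψ.2
  set Ψ : GL (Fin 2) F × GL (Fin 1) F → ℂ := fun x => ∑ i, ψ (kf i * x * (kf i)⁻¹) with hΨ
  have hΨs : IsLocSmooth Ψ := ⟨Literature.Topology.isLocallyConstant_sum_conj hψ.1 kf, Literature.Topology.hasCompactSupport_sum_conj hψ.2 kf⟩
  have hΨK : ∀ k ∈ (glInt 2 F).prod (glInt 1 F), ∀ y, Ψ (k * y * k⁻¹) = Ψ y := fun k hk y => hinv k hk y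
  -- conjugation does not change canonical orbital integrals, so `Ψ` satisfies the same vanishing
  have hOΨ : ∀ (h : GL (Fin 2) F) (u : GL (Fin 1) F),
      (h : Matrix (Fin 2) (Fin 2) F).trace ^ 2 - 4 * (h : Matrix (Fin 2) (Fin 2) F).det ≠ 0 →
      ((h : Matrix (Fin 2) (Fin 2) F).charpoly).eval ((u : Matrix (Fin 1) (Fin 1) F) 0 0) ≠ 0 →
      ∀ (ρ : Measure (Subgroup.centralizer ({(h, u)} : Set (GL (Fin 2) F × GL (Fin 1) F))))
        [ρ.IsHaarMeasure] [ρ.IsInvInvariant],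
        ρ (compactCore (Subgroup.centralizer ({(h, u)} : Set (GL (Fin 2) F × GL (Fin 1) F)))) = 1 →
        orbitalIntegral (h, u) Ψ
          (quotientMeasure (Subgroup.centralizer ({(h, u)} : Set (GL (Fin 2) F × GL (Fin 1) F))) ρ
            (isClosed_coe_centralizer_singleton (h, u)) ν) = 0 := by
    intro h u' hd he ρ _ _ hρ
    have hcl := isClosed_conjClass_pair h hd u'
    have hO0 := hO h u' hd he ρ hρ
    rw [orbitalIntegral_eq_integral_descConj] at hO0 ⊢
    have hpt : descConj (h, u') (Subgroup.centralizer ({(h, u')} : Set (GL (Fin 2) F × GL (Fin 1) F)))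
        (fun _ hg => Subgroup.mem_centralizer_singleton_iff.1 hg) Ψ =
        fun y => ∑ i, descConj (h, u') (Subgroup.centralizer ({(h, u')} : Set (GL (Fin 2) F × GL (Fin 1) F)))
          (fun _ hg => Subgroup.mem_centralizer_singleton_iff.1 hg) (fun x => ψ (kf i * x * (kf i)⁻¹)) y := by
      funext y
      induction y using QuotientGroup.induction_on with
      | H g => simp only [descConj_mk, hΨ]
    have hint : ∀ i, Integrable (descConj (h, u') (Subgroup.centralizer ({(h, u')} : Set (GL (Fin 2) F × GL (Fin 1) F)))
        (fun _ hg => Subgroup.mem_centralizer_singleton_iff.1 hg) (fun x => ψ (kf i * x * (kf i)⁻¹)))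
        (quotientMeasure (Subgroup.centralizer ({(h, u')} : Set (GL (Fin 2) F × GL (Fin 1) F))) ρ
          (isClosed_coe_centralizer_singleton (h, u')) ν) := fun i =>
      integrable_descConj_of_isClosed (h, u') hcl (hψ.continuous.comp ((continuous_const.mul continuous_id).mul continuous_const))
        (Literature.Topology.hasCompactSupport_conj hψ.2 (kf i)) _
    rw [hpt, integral_finsetSum _ fun i _ => hint i]
    refine Finset.sum_eq_zero fun i _ => ?_
    have hpt2 : descConj (h, u') (Subgroup.centralizer ({(h, u')} : Set (GL (Fin 2) F × GL (Fin 1) F)))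
        (fun _ hg => Subgroup.mem_centralizer_singleton_iff.1 hg) (fun x => ψ (kf i * x * (kf i)⁻¹)) =
        fun y => descConj (h, u') (Subgroup.centralizer ({(h, u')} : Set (GL (Fin 2) F × GL (Fin 1) F)))
          (fun _ hg => Subgroup.mem_centralizer_singleton_iff.1 hg) ψ (kf i • y) := by
      funext y
      induction y using QuotientGroup.induction_on with
      | H g =>
        rw [MulAction.Quotient.smul_mk, smul_eq_mul, descConj_mk, descConj_mk]
        congr 1
        group
    haveI := smulInvariantMeasure_quotientMeasure (Subgroup.centralizer ({(h, u')} : Set (GL (Fin 2) F × GL (Fin 1) F))) ρ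
      (isClosed_coe_centralizer_singleton (h, u')) ν
    rw [hpt2, MeasureTheory.integral_smul_eq_self]
    exact hO0
  have key := apply_scalar_eq_zero_of_conj_invariant ν Ψ hΨs hΨK hOΨ hϖ hu hu1 hv1 hdisc z c
  -- `Ψ` at the central element is `nK • ψ`
  have hcent : ∀ i, kf i * (Units.map (Matrix.scalar (Fin 2) : F →+* Matrix (Fin 2) (Fin 2) F).toMonoidHom z,
      Units.map (Matrix.scalar (Fin 1) : F →+* Matrix (Fin 1) (Fin 1) F).toMonoidHom c) * (kf i)⁻¹ =
      (Units.map (Matrix.scalar (Fin 2) : F →+* Matrix (Fin 2) (Fin 2) F).toMonoidHom z,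
       Units.map (Matrix.scalar (Fin 1) : F →+* Matrix (Fin 1) (Fin 1) F).toMonoidHom c) := fun i => by
    refine Prod.ext ?_ ?_
    · show (kf i).1 * z.map ((Matrix.scalar (Fin 2) : F →+* Matrix (Fin 2) (Fin 2) F) : F →* Matrix (Fin 2) (Fin 2) F) * (kf i).1⁻¹ =
        z.map ((Matrix.scalar (Fin 2) : F →+* Matrix (Fin 2) (Fin 2) F) : F →* Matrix (Fin 2) (Fin 2) F)
      rw [← units_map_scalar_mul_comm z (kf i).1, mul_inv_cancel_right]
    · simp only [Prod.snd_mul, Prod.snd_inv]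
      rw [glOne_mul_comm (kf i).2, mul_inv_cancel_right]
  rw [hΨ] at key
  simp only [hcent, Finset.sum_const, Finset.card_univ, Fintype.card_fin, nsmul_eq_mul, mul_eq_zero, Nat.cast_eq_zero] at key
  exact key.resolve_left (by omega)

end Main

end Summit.HodgeConjecture.HodgeConjecture.Cruxes.H413.K2E3GLTwoCentralDensityRamifiedTorus

end
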